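/-
Copyright (c) 2026 the pub-hodgecm-mathlib formalisation cell (harness21).  Prover seat hodgecm-mathlib-LA7-p01 (g3), «GO 500» half A,
organ (S1) of A-p01 (g28)'s `stub_ESHEET` organ map (LA5-plan (g3) DEAL L5-#3), capstone (S1-cap); 2026-09-02.
-/
import Literature.AlgebraicGeometry.AbelianSchemes.SerreTwistFamilyCover
import Literature.AlgebraicGeometry.AbelianSchemes.SerreTwistRelDim
import Literature.AlgebraicGeometry.AbelianSchemes.SerreTwistExactPolarizationAmple
import Literature.AlgebraicGeometry.AbelianSchemes.PolarizedAbelianSchemeWithLevel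
import HarnessLib

/-!
# The Serre-twisted MODULI TUPLE `(A ⊗_𝒪 𝔞⁻¹, D_𝔟, λ_𝔞, η_𝔞) ∈ 𝒜_{g,δ,n}(X)` with its cover, modulo the type-`δ` and symplectic clauses
# ([RapoportSmithlingZhang2020Diagonal] §3.2 ∕ (4.23); [MumfordFogartyKirwan1994] Ch. 7 §2 Def. 7.2; [Lan2013PELCompactifications] Def. 1.3.6.2)

Topic `AlgebraicGeometry/AbelianSchemes`, namespace `Literature.AlgebraicGeometry.AbelianSchemes.AbelianSchemeOver`.  THEOREMS ONLY (no definition, no named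
fact, no `instance`, no notation, no `sorry`); base `S → Spec F` reduced, locally Noetherian, `char F = 0`.  Cell `hodgecm-mathlib` (D-0151), F0∕P6 «MOD», «GO 500»
half A, X-LEAF socket `stub_ESHEET` (E-pen A-p01 (g28) memo 66df4d8c), **organ (S1) capstone (S1-cap)**: the ZIP of ★ `SerreTwistFamilyCover` ((S1a): cover rows,
twisted polarisation and level structure), ★ `SerreTwistRelDim` ((m5)), ★ `SerreTwistExactPolarizationAmple` ((m2): the exact `λ′` is a `Polarization`) into ONE
statement producing every field of `PolarizedAbelianSchemeWithLevel g n δ X` for the twist, the two remaining moduli clauses — (m3) `HasType δ` and (m4)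
`IsSymplecticLiftable` (LA4-p05 (g3)) — entering as IMPLICATION HYPOTHESES in the shape of their heads; `--supports stmt-HodgeConjecture-24832`, count-neutral.
HONEST LABEL: HC_CM is proved only modulo the 7 printed citations (2 remaining: hLiu418 = stmt-HodgeConjecture-24832, h413 = stmt-HodgeConjecture-24833) until rung 0
closes; this file discharges none of them.

## Mathematics

[RapoportSmithlingZhang2020Diagonal] (4.23): for `(A, ι, λ, η) ∈ 𝒜_{g,δ,n}(X)` with `𝒪`-action and an integral ideal `𝔞` (presented à la Serre with scalar `N ∈ 𝔞`,
`(N, n) = 1`, a Rosati pair), the Serre twist `A ⊗_𝒪 𝔞⁻¹` with the exact polarisation `λ′` (`ψ_P^*λ′ = N·λ`) and the pushed-forward level structure `η′ = ψ_P ∘ η` is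
again a point of `𝒜_{g,δ,n}(X)`: `relDim` (★ `isOfRelDim_serreTensor`), `pol` (★ `exists_polarization_lam_eq_of_isExactTwistPol`), `hatNormalised` (the unit pin of
`D_𝔟`), and — GIVEN the type-`δ` transport `hT` and the symplectic transport `hsymp` along `ψ_P` — `hasType`, `symplectic`; together with the cover `c := ψ_P` and its
rows (t1)(t1′)(t2)(t3)(t4)(t5) (★ `exists_serreTwist_cover_rows`), the Rosati law of `λ′` and its uniqueness.

* **`exists_serreTwist_moduliTuple`** — the component bundle `∃ polB η′, relDim ∧ HasType ∧ symplectic ∧ unit pin ∧ rows ∧ Rosati ∧ uniqueness`;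
* **`nonempty_polarizedAbelianSchemeWithLevel_serreTwist`** — `∃ T : PolarizedAbelianSchemeWithLevel g n δ S` with `T.A = A ⊗ 𝔟` (the record assembled).

## References
* [RapoportSmithlingZhang2020Diagonal] M. Rapoport, B. Smithling, W. Zhang (2020), §3.2 (p. 11), §4.3 (4.23) (p. 21).
* [MumfordFogartyKirwan1994] D. Mumford, J. Fogarty, F. Kirwan, *Geometric Invariant Theory*, 3rd ed. (1994), Ch. 7 §2 Definition 7.2 (p. 129), Ch. 6 §2 Def. 6.3 (p. 120).
* [Lan2013PELCompactifications] K.-W. Lan, *Arithmetic compactifications of PEL-type Shimura varieties* (2013), Def. 1.3.6.2 (p. 80).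
* [MumfordAV1970] D. Mumford, *Abelian Varieties* (1970), §7 Thm. 4 (p. 72), §23 Thm. 2 (p. 231).
-/

set_option autoImplicit false

-- as the ★ Serre-tensor files: `Over`/`Scheme` wrappers and `Scheme.Modules` are semireducible
set_option backward.isDefEq.respectTransparency false

noncomputable section

universe u

open CategoryTheory CategoryTheory.Limits AlgebraicGeometry MonoidalCategory CartesianMonoidalCategory
open scoped MonObj

namespace Literature.AlgebraicGeometry.AbelianSchemes

namespace AbelianSchemeOver

variable {S : Scheme.{u}} [IsReduced S] [IsLocallyNoetherian S] {A : AbelianSchemeOver S} {O : Type*} [CommRing O] (act : A.RingAction O)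
  [IsCommMonObj A.X] {m : ℕ} (E' : Matrix (Fin m) (Fin m) O) (hE' : E' * E' = E') (P : Matrix (Fin m) (Fin 1) O) (Q : Matrix (Fin 1) (Fin m) O)
  {N : ℕ} (D : A.DualPair) (Db : (serreTensor act E' hE').DualPair)
  (hD : Nonempty ((Scheme.Modules.pullback (DualPair.unitHatSlice D)).obj D.P ≅ SheafOfModules.unit _))
  (hDb : Nonempty ((Scheme.Modules.pullback (DualPair.unitHatSlice Db)).obj Db.P ≅ SheafOfModules.unit _))
  (pol : A.Polarization D) (σ : O → O)

include hD in
/-- **THE SERRE-TWISTED MODULI TUPLE, COMPONENT FORM.**  Base `S → Spec F` (`char F = 0`) reduced and locally Noetherian, `𝒪` a domain of characteristic `0`; a Serre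
presentation `(E′, P, Q, N)` of `𝔞⁻¹` (`N ≠ 0`, coordinates of `P` generating `𝔞`), a Rosati pair `1 − a ∈ 𝔞`, `b ∈ 𝔞`, `ι(a) ≫ λ = λ ≫ ι(b)^∨`, the Rosati law
`ι(σ x) ≫ λ = λ ≫ ι(x)^∨`, `A` of relative dimension `g`, a level-`n` structure `η` with `(N, n) = 1`, a dual pair `D_𝔟` of `A ⊗ 𝔟` with its unit pin, and the two
transports along `ψ_P` as hypotheses — `hT`: every polarisation structure on an exact `λ′` has type `δ` (LA4-p05's (m3) head shape); `hsymp`: for such a structure the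
pushed-forward level structure is symplectic-liftable of type `δ` ((m4)).  THEN there are a POLARISATION `polB` of `A ⊗ 𝔟` for `D_𝔟` and a level-`n` structure `η′` with:
`(A ⊗ 𝔟).IsOfRelDim g`, `polB.HasType δ`, `η′.IsSymplecticLiftable polB δ`, the cover rows (t1)(t1′)+surjectivity(t2)(t3)(t4)(t5) for `c := ψ_P` (with `polB.lam`), the
Rosati law of `polB.lam` for `ι_𝔟`, and uniqueness of `polB.lam` among exact homomorphisms — i.e. every field of `(A ⊗ 𝔞⁻¹, D_𝔟, λ_𝔞, η_𝔞) ∈ 𝒜_{g,δ,n}(S)` plus its cover.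
[cite: RapoportSmithlingZhang2020Diagonal, §3.2 (p. 11) and §4.3 (4.23) (p. 21)] [cite: MumfordFogartyKirwan1994, Ch. 7 §2 Definition 7.2 (p. 129)]
[cite: MumfordAV1970, §7 Thm. 4 (p. 72), §23 Thm. 2 (p. 231)] -/
theorem exists_serreTwist_moduliTuple [IsDomain O] [CharZero O] {F : Type u} [Field F] [CharZero F] (f : S ⟶ Spec (.of F))
    (hN : N ≠ 0) (hP : E' * P = P) (hQ : Q * E' = Q)
    (hQP : Q * P = Matrix.scalar (Fin 1) (N : O)) (hPQ : P * Q = Matrix.scalar (Fin m) (N : O) * E')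
    {𝔞 : Ideal O} (h𝔞 : Ideal.span (Set.range fun k => P k 0) = 𝔞) {a b : O}
    (hab : haveI := act.isMonHom b; act.i a ≫ pol.lam = pol.lam ≫ DualPair.dualIsogenyOver (act.i b) D D)
    (ha : 1 - a ∈ 𝔞) (hb : b ∈ 𝔞) (hlam : ∀ x, act.i (σ x) ≫ pol.lam = pol.lam ≫ (act.dual D hD).i x)
    {g n : ℕ} {δ : Fin g → ℕ} (hA : A.IsOfRelDim g) (lvl : A.LevelStructure g n) (hcop : Nat.Coprime N n)
    (hT : ∀ polB : (serreTensor act E' hE').Polarization Db, IsExactTwistPol act E' hE' P D Db pol N polB.lam → polB.HasType δ)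
    (hsymp : ∀ (polB : (serreTensor act E' hE').Polarization Db) (lvl' : (serreTensor act E' hE').LevelStructure g n),
      IsExactTwistPol act E' hE' P D Db pol N polB.lam → (∀ i, lvl'.σ i = lvl.σ i ≫ serreTranslate act E' hE' P) →
        lvl'.IsSymplecticLiftable polB δ) :
    ∃ (polB : (serreTensor act E' hE').Polarization Db) (lvl' : (serreTensor act E' hE').LevelStructure g n),
      -- the moduli fields
      (serreTensor act E' hE').IsOfRelDim g ∧ polB.HasType δ ∧ lvl'.IsSymplecticLiftable polB δ ∧
      -- (t1) two-sided Serre presentation of `𝔞`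
      (∀ x ∈ 𝔞, ∃ d : (serreTensor act E' hE').X ⟶ A.X, IsMonHom d ∧
        serreTranslate act E' hE' P ≫ d = act.i x ∧ d ≫ serreTranslate act E' hE' P = (serreAction act E' hE').i x) ∧
      -- (t1′) kernel on all `T`-points; surjectivity
      (∀ ⦃T : Over S⦄ (t : T ⟶ A.X), t ≫ serreTranslate act E' hE' P = 1 ↔ ∀ x ∈ 𝔞, t ≫ act.i x = 1) ∧
      Function.Surjective (serreTranslate act E' hE' P).left.base ∧
      -- (t2) upper bound through `(N) ⊇ y·𝔞`
      (∀ y : O, (∀ x ∈ 𝔞, y * x ∈ Ideal.span {(N : O)}) → ∃ f : A.X ⟶ (serreTensor act E' hE').X, IsMonHom f ∧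
        serreTranslate act E' hE' P ≫ (serreAction act E' hE').i y = f ≫ (serreAction act E' hE').i (N : O)) ∧
      -- (t3) `c^* λ′ = N • λ`
      (haveI := isMonHom_serreTranslate act E' hE' P
       serreTranslate act E' hE' P ≫ polB.lam ≫ DualPair.dualIsogenyOver (serreTranslate act E' hE' P) D Db = pol.lam ≫ D.hat.mulN N) ∧
      -- (t4) equivariance
      (∀ x : O, act.i x ≫ serreTranslate act E' hE' P = serreTranslate act E' hE' P ≫ (serreAction act E' hE').i x) ∧
      -- (t5) level sections, at the basis and at every `a`
      (∀ i, lvl'.σ i = lvl.σ i ≫ serreTranslate act E' hE' P) ∧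
      (∀ c : Fin g ⊕ Fin g → ZMod n, lvl'.section_ c = lvl.section_ c ≫ serreTranslate act E' hE' P) ∧
      -- Rosati law of `λ′`
      (∀ x : O, (serreAction act E' hE').i (σ x) ≫ polB.lam = polB.lam ≫ ((serreAction act E' hE').dual Db hDb).i x) ∧
      -- uniqueness
      (∀ lam'' : (serreTensor act E' hE').X ⟶ Db.hat.X, IsMonHom lam'' →
        (haveI := isMonHom_serreTranslate act E' hE' P
         serreTranslate act E' hE' P ≫ lam'' ≫ DualPair.dualIsogenyOver (serreTranslate act E' hE' P) D Db = pol.lam ≫ D.hat.mulN N) →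
        lam'' = polB.lam) := by
  obtain ⟨lam', hmon, lvl', ht1, ht1', hsurj, ht2, ht3, ht4, ht5, hros, huniq⟩ :=
    exists_serreTwist_cover_rows act E' hE' P Q D Db hD hDb pol σ hN hP hQ hQP hPQ h𝔞 hab ha hb hlam lvl hcop
  haveI := hmon
  have hex : IsExactTwistPol act E' hE' P D Db pol N lam' := (isExactTwistPol_iff act E' hE' P D Db pol N lam').mpr ht3
  obtain ⟨polB, hpolB⟩ := exists_polarization_lam_eq_of_isExactTwistPol act E' hE' P Q D Db hD hDb pol f hN hP hQ hQP hPQ hex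
  have hexB : IsExactTwistPol act E' hE' P D Db pol N polB.lam := by rw [hpolB]; exact hex
  refine ⟨polB, lvl', isOfRelDim_serreTensor act E' hE' P Q hN hP hQ hQP hPQ hA, hT polB hexB, hsymp polB lvl' hexB ht5,
    ht1, ht1', hsurj, ht2, ?_, ht4, ht5, ?_, ?_, ?_⟩
  · rw [hpolB]; exact ht3
  · intro c
    exact LevelStructure.section_eq_section_comp_serreTranslate act E' hE' P ht5 c
  · intro x
    rw [hpolB]; exact hros x
  · intro lam'' hmon'' h''
    rw [hpolB]; exact huniq lam'' hmon'' h''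

include hD hDb in
/-- **THE SERRE TWIST IS A POINT OF `𝒜_{g,δ,n}(S)`** (record form): under the hypotheses of `exists_serreTwist_moduliTuple` there is
`T : PolarizedAbelianSchemeWithLevel g n δ S` with `T.A = A ⊗_𝒪 𝔟` — [MumfordFogartyKirwan1994] Def. 7.2 ∕ [Lan2013PELCompactifications] Def. 1.3.6.2 for the twisted tuple
`(A ⊗ 𝔞⁻¹, λ_𝔞, η_𝔞)` of [RapoportSmithlingZhang2020Diagonal] (4.23) (the component form carries the cover and exactness; this form only records membership).
[cite: MumfordFogartyKirwan1994, Ch. 7 §2 Definition 7.2 (p. 129)] [cite: Lan2013PELCompactifications, §1.3.6 Def. 1.3.6.2 (p. 80)]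
[cite: RapoportSmithlingZhang2020Diagonal, §4.3 (4.23) (p. 21)] -/
theorem exists_polarizedAbelianSchemeWithLevel_serreTwist [IsDomain O] [CharZero O] {F : Type u} [Field F] [CharZero F] (f : S ⟶ Spec (.of F))
    (hN : N ≠ 0) (hP : E' * P = P) (hQ : Q * E' = Q)
    (hQP : Q * P = Matrix.scalar (Fin 1) (N : O)) (hPQ : P * Q = Matrix.scalar (Fin m) (N : O) * E')
    {𝔞 : Ideal O} (h𝔞 : Ideal.span (Set.range fun k => P k 0) = 𝔞) {a b : O}
    (hab : haveI := act.isMonHom b; act.i a ≫ pol.lam = pol.lam ≫ DualPair.dualIsogenyOver (act.i b) D D)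
    (ha : 1 - a ∈ 𝔞) (hb : b ∈ 𝔞) (hlam : ∀ x, act.i (σ x) ≫ pol.lam = pol.lam ≫ (act.dual D hD).i x)
    {g n : ℕ} {δ : Fin g → ℕ} (hA : A.IsOfRelDim g) (lvl : A.LevelStructure g n) (hcop : Nat.Coprime N n)
    (hT : ∀ polB : (serreTensor act E' hE').Polarization Db, IsExactTwistPol act E' hE' P D Db pol N polB.lam → polB.HasType δ)
    (hsymp : ∀ (polB : (serreTensor act E' hE').Polarization Db) (lvl' : (serreTensor act E' hE').LevelStructure g n),
      IsExactTwistPol act E' hE' P D Db pol N polB.lam → (∀ i, lvl'.σ i = lvl.σ i ≫ serreTranslate act E' hE' P) →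
        lvl'.IsSymplecticLiftable polB δ) :
    ∃ T : PolarizedAbelianSchemeWithLevel g n δ S, T.A = serreTensor act E' hE' := by
  obtain ⟨polB, lvl', hrel, hTB, hs, -⟩ := exists_serreTwist_moduliTuple act E' hE' P Q D Db hD hDb pol σ f hN hP hQ hQP hPQ h𝔞 hab
    ha hb hlam hA lvl hcop hT hsymp
  exact ⟨⟨serreTensor act E' hE', hrel, Db, polB, hTB, lvl', hs, hDb⟩, rfl⟩

end AbelianSchemeOver

end Literature.AlgebraicGeometry.AbelianSchemes

end
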